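import Mathlib.Analysis.SpecialFunctions.Pow.Real
import Mathlib.Analysis.SpecialFunctions.Pow.Asymptotics
import HarnessLib

/-!
# Luo–Titi 2020, Lemma 1 with intermittent jets: the `θ`-dependent parameter regime
  (why the hyperviscous error is controllable exactly for `θ < 5/4`)

Analysis/FluidPDE proofs-only file (elementary real arithmetic; no definitions, no named facts)
for the proof of the Iteration Lemma of T. Luo and E. S. Titi, Calc. Var. PDE 59 (2020) =
arXiv:1808.07595 (`Torus.LuoTiti2020_iterationLemma`, `FluidPDE/FractionalNSReynolds`) along the
tree's intermittent-JET construction (`FluidPDE/JetPerturbation`, `LuoTitiPerturbation`) instead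
of the printed intermittent Beltrami flows. The paper's §3.5 ends with the choice of parameters
"`r = λ^α`, `σ = λ^{-(α+1)/2}`, `μ = λ^{(5α+1)/4}`" with `max{0, (2/3)(2θ-1)} < α < 1` and `p > 1`
close to `1`, under which every error term of the new stress is a negative power of `λ_{q+1}`;
"we must have `θ < 5/4` in order that the second term in (3.20) is small". This file records the
corresponding exponent count for the jet blocks of the tree and PROVES that it closes for every
`θ ∈ [1, 5/4)`.

## The count (soft setting of Lemma 1: `(v_q, R_q)` fixed, so all amplitude constants
`A₀, A₁, A₂, H₁, H₂` of `JetStep.Datum.AmpBounds` and `sup|v_q|`, `sup|ψ'|` are constants)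

Write the jet parameters of `JetStep.Datum` as powers of a large `L`: cell frequency `σ = L^s`,
axial concentration `κ = L^k`, transverse concentration `μ = L^m`, temporal parameter
`μ' = L^n`, and let `q = 1/p ∈ (0,1)` be the inverse Lebesgue exponent of the Calderón–Zygmund
steps. A jet has height `H = κ^{1/2} μ` (`Jet.Bounds`: `|η| ≤ Bκ^{1/2}`, `|ψ̃| ≤ Bμ`), is supported
on a set of measure `|E| ≲ κ⁻¹ μ⁻²` (`JetSupports`), and each space derivative costs `σμ`
(transverse; the axial cost `σκ` is smaller once `k ≤ m`, `JetDerivBounds`). The error terms of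
the new stress (the size functions of `JetStepTheorem` / `JetStressEstimates`, and the
hyperviscous term of `FracHyperviscousEstimate`) are then bounded by constants times:

* `‖w^{(p)}‖_{L¹} ~ κ^{-1/2}μ^{-1}` (always small); `‖w^{(c)}‖_{L¹} ~ κ^{1/2}μ^{-2}`,
  `sup|w^{(c)}| · ‖w^{(c)}‖_{L¹} ~ κ² μ^{-2}`                       — small iff **`k < m`**;
* `‖X‖²_{L²} ~ μ'^{-2} κ μ²` (temporal corrector)                  — small iff **`k + 2m < 2n`**;
* `‖ℛ ∂ₜ(w^{(p)}+w^{(c)})‖` through `σ μ' · KetaD(p)`, `KetaD ~ σ⁻¹ κ^{3/2-q} μ^{-2q}`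
  (`JetF1Estimate`)                                                — **`n + k(3/2-q) - 2mq < 0`**,
  and through `Keta ~ σ⁻¹ κ^{1/2-q} μ^{-2q}`                        — **`-s + k(1/2-q) - 2mq < 0`**;
* oscillation stress and remainder `~ σ⁻¹`, slow source `~ μ'⁻¹`    — `s > 0`, `n > 0`;
* **hyperviscous term** `‖ℛ((-Δ)^θ w_loc)‖_{L¹} ≲ S₁^{2-θ} S₃^{θ-1} |E|^{q}` with
  `S₁ ~ (σμ)·H`, `S₃ ~ (σμ)³·H` for the `ψ(w^{(p)}+w^{(c)})` part      — **`(2θ-1)(s+m) + k/2 + m - q(k+2m) < 0`**,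
  and `S₁ ~ μ'⁻¹(σμ)H²`, `S₃ ~ μ'⁻¹(σμ)³H²` for the `ψ²X` part (equally, the CZ bound
  `μ'⁻¹(σμ)^{2θ-1}‖F‖_{L^p}` if the gradient part `∇(ψ²ζ)` is not moved into the pressure)
                                                                    — **`(2θ-1)(s+m) + k + 2m - n - q(k+2m) < 0`**.

Normalise `m = 1`. At `q = 1`, `s = 0` the two hyperviscous lines read `k > 4θ - 4` and
`n > 2θ - 1`, while `k + 2 < 2n` and `n + k/2 < 2` (the `KetaD` line) force `k < 1` and
`n < 3/2`; so the system closes iff `4θ - 4 < 1`, i.e. **`θ < 5/4`**, J.-L. Lions' exponent,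
exactly as printed — whereas the fixed regime of `JetStepArithmetic`
(`s, k, m, n = 3/16, 1/2, 13/16, 5/4`, built for `θ = 1`) satisfies the first hyperviscous line
only for `θ < 33/32`. The admissible choice proved below is, with `η = 5/4 - θ ∈ (0, 1/4]`:
`s = η/8`, `k = 1 - η`, `m = 1`, `n = 3/2 - η/4`, `q = 1 - η/100` (jets almost isotropic,
`κ ≈ μ`, cells almost unit size, `p` barely above `1`).

## Contents (all proved)

* `LuoTiti.regime_exponents` — for `1 ≤ θ < 5/4` there are exponents `s, k, m, n > 0` and
  `q ∈ (0,1)` satisfying the seven strict inequalities displayed above (and `k < m`).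
* `LuoTiti.exists_forall_mul_rpow_le` — `K L^e ≤ ε` for `L ≥ L₀(K, e, ε)` when `e < 0`
  (how each error term is made `≤ δ_{q+2}/N` "by taking `λ_{q+1}` sufficiently large");
  `LuoTiti.exists_nat_cell_frequency` — an integer `σ` with `L^s ≤ σ ≤ 2L^s` (the cell
  frequency of `JetStep.Datum` is a natural number).

## References

* T. Luo, E. S. Titi, Calc. Var. PDE 59 (2020) = arXiv:1808.07595, §3.5 (3.20) and the closing
  paragraph "Now we choose the parameters `r, σ, μ` …". [`LuoTiti2020`]
* T. Buckmaster, V. Vicol, EMS Surv. Math. Sci. 6 (2019) = arXiv:1901.09023, §7.7 (the jet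
  regime for `θ = 1`). [`BuckmasterVicol2020`]
-/

noncomputable section

open Filter

namespace Literature.Analysis.FluidPDE

namespace LuoTiti

/-- **The `θ`-dependent jet regime closes for every `θ ∈ [1, 5/4)`.** There are exponents
`s, k, m, n > 0` (cell frequency `σ = L^s`, axial concentration `κ = L^k`, transverse
concentration `μ = L^m`, temporal parameter `μ' = L^n`) and an inverse Lebesgue exponent
`q = 1/p ∈ (0, 1)` such that every error exponent of the jet step for the fractional system is
negative: `k < m` (correctors), `k + 2m < 2n` (temporal corrector), `n + k(3/2 - q) - 2mq < 0` and
`-s + k(1/2 - q) - 2mq < 0` (time-derivative source through `ℛ div` on `L^p`), and the two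
hyperviscous lines `(2θ-1)(s+m) + k/2 + m - q(k+2m) < 0`, `(2θ-1)(s+m) + k + 2m - n - q(k+2m) < 0`.
Witness: `η = 5/4 - θ`, `(s, k, m, n, q) = (η/8, 1-η, 1, 3/2-η/4, 1-η/100)`. This is the jet
analogue of the printed choice "`r = λ^α, σ = λ^{-(α+1)/2}, μ = λ^{(5α+1)/4}`,
`max{0, (2/3)(2θ-1)} < α < 1`", possible "since `θ ∈ (-∞, 5/4)`".
[cite: LuoTiti2020, §3.5 (choice of parameters after (3.20))] -/
theorem regime_exponents {θ : ℝ} (h1 : 1 ≤ θ) (h2 : θ < 5 / 4) :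
    ∃ s k m n q : ℝ, 0 < s ∧ 0 < k ∧ 0 < m ∧ 0 < n ∧ 0 < q ∧ q < 1 ∧ k < m ∧
      k + 2 * m < 2 * n ∧
      n + k * (3 / 2 - q) - 2 * m * q < 0 ∧
      -s + k * (1 / 2 - q) - 2 * m * q < 0 ∧
      (2 * θ - 1) * (s + m) + k / 2 + m - q * (k + 2 * m) < 0 ∧
      (2 * θ - 1) * (s + m) + k + 2 * m - n - q * (k + 2 * m) < 0 := by
  set η : ℝ := 5 / 4 - θ with hη_def
  have hη : 0 < η := by rw [hη_def]; linarith
  have hη4 : η ≤ 1 / 4 := by rw [hη_def]; linarith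
  have hθ : θ = 5 / 4 - η := by rw [hη_def]; ring
  refine ⟨η / 8, 1 - η, 1, 3 / 2 - η / 4, 1 - η / 100, by positivity, by linarith, one_pos, by linarith,
    by linarith, by linarith, by linarith, by linarith, ?_, ?_, ?_, ?_⟩
  · nlinarith [mul_pos hη hη]
  · nlinarith [mul_pos hη hη]
  · rw [hθ]; nlinarith [mul_pos hη hη, mul_pos (mul_pos hη hη) hη]
  · rw [hθ]; nlinarith [mul_pos hη hη, mul_pos (mul_pos hη hη) hη]

/-- **"Taking `λ_{q+1}` sufficiently large"**: a constant times a negative power of `L` is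
eventually below any `ε > 0` — for `e < 0`, `0 < ε` there is `L₀ ≥ 1` with `K L^e ≤ ε` for all
`L ≥ L₀`. [folklore] -/
theorem exists_forall_mul_rpow_le (K : ℝ) {e : ℝ} (he : e < 0) {ε : ℝ} (hε : 0 < ε) :
    ∃ L₀ : ℝ, 1 ≤ L₀ ∧ ∀ L : ℝ, L₀ ≤ L → K * L ^ e ≤ ε := by
  have h0 : Tendsto (fun L : ℝ => L ^ e) atTop (nhds 0) := by
    simpa only [neg_neg] using tendsto_rpow_neg_atTop (by linarith : 0 < -e)
  have ht : Tendsto (fun L : ℝ => K * L ^ e) atTop (nhds 0) := by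
    simpa only [mul_zero] using h0.const_mul K
  have hev : ∀ᶠ L in atTop, K * L ^ e ≤ ε := (ht.eventually (Iio_mem_nhds hε)).mono fun L hL => hL.le
  obtain ⟨L₁, hL₁⟩ := hev.exists_forall_of_atTop
  exact ⟨max 1 L₁, le_max_left _ _, fun L hL => hL₁ L ((le_max_right _ _).trans hL)⟩

/-- Finitely many negative powers at once: for exponents `e i < 0` and constants `K i` on a
finite index type, one threshold `L₀` makes every `K i L^{e i} ≤ ε`. [folklore] -/
theorem exists_forall_mul_rpow_le_finite {ι : Type*} [Finite ι] (K e : ι → ℝ) (he : ∀ i, e i < 0)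
    {ε : ℝ} (hε : 0 < ε) :
    ∃ L₀ : ℝ, 1 ≤ L₀ ∧ ∀ L : ℝ, L₀ ≤ L → ∀ i, K i * L ^ e i ≤ ε := by
  classical
  haveI := Fintype.ofFinite ι
  choose L₀ hL₀ h using fun i => exists_forall_mul_rpow_le (K i) (he i) hε
  rcases isEmpty_or_nonempty ι with hι | hι
  · exact ⟨1, le_rfl, fun L _ i => (IsEmpty.false i).elim⟩
  · refine ⟨max 1 (Finset.univ.sup' Finset.univ_nonempty L₀), le_max_left _ _, fun L hL i => h i L ?_⟩
    exact ((Finset.le_sup' L₀ (Finset.mem_univ i)).trans (le_max_right _ _)).trans hL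

/-- **An integer cell frequency of prescribed order**: for `L ≥ 1` and `s ≥ 0` there is a
natural number `σ ≥ 1` with `L^s ≤ σ ≤ 2 L^s` (the cell frequency of `JetStep.Datum` is an
integer; `σ = ⌈L^s⌉`). [folklore] -/
theorem exists_nat_cell_frequency {L s : ℝ} (hL : 1 ≤ L) (hs : 0 ≤ s) :
    ∃ σ : ℕ, 0 < σ ∧ L ^ s ≤ (σ : ℝ) ∧ (σ : ℝ) ≤ 2 * L ^ s := by
  have h1 : 1 ≤ L ^ s := Real.one_le_rpow hL hs
  refine ⟨⌈L ^ s⌉₊, Nat.ceil_pos.2 (by linarith), Nat.le_ceil _, ?_⟩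
  calc (⌈L ^ s⌉₊ : ℝ) ≤ L ^ s + 1 := (Nat.ceil_lt_add_one (by linarith)).le
    _ ≤ 2 * L ^ s := by linarith

end LuoTiti

end Literature.Analysis.FluidPDE
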